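import Summits.HubbardSuperconductivity.HubbardSuperconductivity.Theorems.NodalWardXYPerturbedXYOrderEquivalence

/-!
# `PerturbedXYOrder` (stmt-HubbardSuperconductivity-10739) — line `schwarz-inheritance`, stub `stub_linearResponseOfCrux`

**Linear response is bounded under the crux.**  If `PerturbedXYOrder` holds, then by the landed converse
`complexStability_of_perturbedXYOrder` there are `J₀`, `ε₂ > 0`, `B > 0` with `Z_K ≠ 0 ∧ ‖num_K/Z_K/L⁶‖ ≤ B` for every kernel
admissible at radius `ε₂`, `J ≥ J₀`, `L ≥ 2`.  For such a `K` the ray `t ↦ t • K` stays admissible at radius `ε₂` on the closed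
unit `t`-disc (`sch_admissible_smul`), so `f(t) = cratio L J (t • K)` is holomorphic there (`equiv_differentiableAt_cratio_ray`)
and bounded by `B` on the unit circle; Cauchy's estimate (`Complex.norm_deriv_le_of_forall_mem_sphere_norm_le`, radius `1`)
gives `‖f'(0)‖ ≤ B`, uniformly in `L`.  The data of the conclusion are `(J₀, ε₂, C = B)`.
-/

noncomputable section

namespace Summit.HubbardSuperconductivity.HubbardSuperconductivity.Theorems.PerturbedXYOrder

open MeasureTheory Literature.Probability.LatticeModels
open Summit.HubbardSuperconductivity.HubbardSuperconductivity.Theses.NodalWardXY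

/-- Along the ray through a kernel admissible at radius `ε` (`0 ≤ ε`), every `t • K` with `‖t‖ ≤ 1` is admissible at the
same radius. -/
theorem lr_admissible_unit_ray {L : ℕ} [NeZero L] {ε : ℝ} (hε : 0 ≤ ε) {K : Bond L → Bond L → ℂ}
    (hK : Admissible L ε K) {t : ℂ} (ht : ‖t‖ ≤ 1) : Admissible L ε (t • K) :=
  sch_admissible_smul (mul_le_of_le_one_left hε ht) hK

/-- **Linear response is bounded under the crux.** If `PerturbedXYOrder` holds, there are `J₀`, `ε > 0`, `C` such that for
`J ≥ J₀`, `L ≥ 2` and every kernel `K` admissible at radius `ε`, the derivative at `t = 0` of the complex plateau along the ray,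
`t ↦ cratio L J (t • K)`, has norm at most `C`, uniformly in `L`: Cauchy's estimate on the unit `t`-disc, where the plateau is
holomorphic (`Z ≠ 0`, `equiv_differentiableAt_cratio_ray`) and bounded by `B` (`complexStability_of_perturbedXYOrder`). -/
theorem stub_linearResponseOfCrux :
    PerturbedXYOrder → ∃ J₀ ε C : ℝ, 0 < ε ∧ ∀ J : ℝ, J₀ ≤ J → ∀ (L : ℕ) [NeZero L], 2 ≤ L →
      ∀ K : Bond L → Bond L → ℂ, Admissible L ε K → ‖deriv (fun t : ℂ => cratio L J (t • K)) 0‖ ≤ C := by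
  intro h
  obtain ⟨J₀, ε₂, B, hε₂, -, hCS⟩ := complexStability_of_perturbedXYOrder h
  refine ⟨J₀, ε₂, B, hε₂, ?_⟩
  intro J hJ L _ hL K hK
  -- complex stability along the ray `t • K`, `‖t‖ ≤ 1`
  have hray : ∀ t : ℂ, ‖t‖ ≤ 1 → Zk J (t • K) ≠ 0 ∧ ‖cratio L J (t • K)‖ ≤ B :=
    fun t ht => hCS J hJ L hL (t • K) (lr_admissible_unit_ray hε₂.le hK ht)
  -- holomorphic on the closed unit disc, hence `DiffContOnCl` on the open one
  have hd : DiffContOnCl ℂ (fun s : ℂ => cratio L J (s • K)) (Metric.ball 0 1) := by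
    refine DifferentiableOn.diffContOnCl_ball (U := Metric.closedBall 0 1) (fun t ht => ?_) subset_rfl
    exact (equiv_differentiableAt_cratio_ray J K (hray t (mem_closedBall_zero_iff.1 ht)).1).differentiableWithinAt
  -- bounded by `B` on the unit circle
  have hC : ∀ z ∈ Metric.sphere (0 : ℂ) 1, ‖cratio L J (z • K)‖ ≤ B :=
    fun z hz => (hray z (mem_sphere_zero_iff_norm.1 hz).le).2
  exact (Complex.norm_deriv_le_of_forall_mem_sphere_norm_le one_pos hd hC).trans_eq (div_one B)

end Summit.HubbardSuperconductivity.HubbardSuperconductivity.Theorems.PerturbedXYOrder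

end
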